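import Literature.MathematicalPhysics.QuantumFieldTheory.Balaban1983to89.B9Eq3126KFloorWindowedTower
import Literature.MathematicalPhysics.QuantumFieldTheory.Balaban1983to89.B9Eq3126KFloorDiagonal

/-!
# `Balaban1983to89.B9Eq3126KFloorWindowedDiagonal` — T. Bałaban, *Propagators for lattice gauge theories in a background field*, Commun. Math. Phys. **99**
# (1985) 389–434 [Balaban1985BackgroundPropagators] (3.126) p. 420, Thm 3.11 p. 416, (3.79) p. 406, with [Balaban1985Variational] (45)–(46) p. 285
# («B₀ … uniform»): **THE WINDOWED `k`-LEVEL LETTERS `(Q_k(U)G_k(U)Q_k(U)†)⁻¹`, `H_{1,k}(U)` OF THE pub-balaban NE9 CHAIN ON PRINT's DIAGONAL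
# `ηL^{n+1} = 1`, `c₀(L^{n+1})^d = c₁` ARE BOUNDED BY `Ξ_U(d, a, ‖η⁻¹‖εR, Kc, δQ)` AND `√(Ξ_U∕γ)` — NO block size, NO level count, NO volume, NO operator
# bound; the smallness asked of the averaging letter is the pure-`d` condition `δQ·1215(27∕4)^{d−1} ≤ 1∕2`** (the arithmetic corollary of
# `B9Eq3126KFloorWindowedTower`, as `B9Eq3126KFloorDiagonal` was of `B9Eq3126KFloorFlat`)

statement-level skeleton of published theorems with citation tags; proofs where landed; nothing here is a claim about the Yang–Mills mass gap

CITATION HEADER (lean-in-tree rule).  Audit cell `pub-balaban`, sub-cell `t4`, BINDER row NE9; filed by NE9 formalisation-swarm LEAF PROVER 02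
(`b2b-balaban-t4-ne9-formalise-leaf-02`, gen 65).  Sources as `B9Eq3126KFloorWindowedTower` (this lineage): [Balaban1985BackgroundPropagators] pp. 395–397,
404–406, 416, 420; [Balaban1985Variational] p. 285; [Balaban1985Averaging] p. 36.

THE PRINT (verbatim).  [B11] p. 285: *«… the Theorem 3.12 from [5] implies |HB| ≤ B₀(L^jη)^{−1}|B|, |∇HB| ≤ B₀(L^jη)^{−2}|B| on Ω_j. (46)»* with `B₀` independent of
the lattice and of `j`; [B9] p. 416, Thm 3.11: *«There exist positive constants α₀, γ₀ such that for U satisfying (3.79) with arbitrary α₁ ≤ α₀ … the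
operators Δ′_a, G′, (Q′G′²Q′*)⁻¹, Δ_a, G are positive definite … uniformly bounded»*; p. 420, (3.126): *«HB = GQ*(QGQ*)⁻¹B»*.

WHY THIS FILE (cell context).  `B9Eq3126KFloorWindowedTower` bounds the two windowed letters by `M_U∕β_U²` (and `√(·∕γ)`), `β_U = (A − B) − δQ·N`, under the
displayed positivity `β_U > 0`.  Here the arithmetic at print's point: `N = L′³(L′²∕4)^{d−1} = 1215(27∕4)^{d−1}·β₀` with `β₀ ≤ A − B` the tent's margin floor, so
the pure-`d` smallness `δQ·1215(27∕4)^{d−1} ≤ 1∕2` gives `β_U ≥ (A − B)∕2`, and with `M_u ≤ Ξ(d,a)(A − B)²` (`B9Eq3126KFloorDiagonal.tent_ratio_le_diagonal`) and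
`N ≤ 1215(27∕4)^{d−1}(A − B)` every power of `L′ = L^{n+1}` cancels: `M_U∕β_U² ≤ Ξ_U`.  What is left level-carrying is the product `‖η⁻¹‖εR` — equal to
`2M_φM_φ′α` for the bond window `‖U(b) − 1‖ ≤ αη` — and the letters `Kc ∝ α`, `δQ ∝ α` of the windows: discharging them (and `γ`, `hsym`, `hRS` from the
OWNER's tower theorems) is the next file.

WHAT IS PROVED (sorry-free; 0 `def`; [folklore] real arithmetic on the previous file's bound; nothing of [B9]∕[B11] asserted).
* `ratio_abstract` — letters only: `0 < β₀ ≤ D`, `N = νβ₀`, `δQν ≤ 1∕2`, `Mu∕D² ≤ Ξ`, `E ≥ 0` ⇒ `0 < D − δQN` and `(2Mu + EN²)∕(D − δQN)² ≤ 8Ξ + 4Eν²`.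
* `windowed_ratio_le_diagonal` — the instance at print's point with the tent's numbers (`size_ident`: `L³(L²∕4)^{d−1} = 1215(27∕4)^{d−1}β₀`).
* **`norm_KinvLatticeK_H1LatticeK_tower_windowed_le_diagonal`** — the previous file's theorem with `β_U > 0` REPLACED by `δQ·1215(27∕4)^{d−1} ≤ 1∕2` and the
  constants `Ξ_U`, `√(Ξ_U∕γ)`.
HONEST SCOPE.  Crude constants; the letters `εR, Kc, δQ, γ, hsym, hRS` displayed (discharged from the windows in the sequel); NOT print's kernel bound (46) ∕
[B9] Thm 3.12 (decay), only the `L²`-operator shadow; NOT NE9, NOT the route (cell pub-balaban: NE9 NOT PRINTED ∕ NOT PROVED; «NE9 ⇐ the named binders»; row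
WALLED ON A MODEL (O-NE9-1; #5 UNRULED); spine PROVED 0∕9; rung (B)+1 on a finite T⁴ — NOT infinite volume, NOT mass gap, NOT BetaPertH, NOT Clay).  HONEST
DEPENDENCY (cell line): continuum YM on T⁴ ⇐ BetaPertH ∧ nine spine estimates (0/9 proved); BetaPertH ⇐ (D1) ∧ (D4) ∧ CAP+tail; G-an2-4 gates asym, D1 and
NE2/3/4.  NEW file importing `B9Eq3126KFloorWindowedTower`, `B9Eq3126KFloorDiagonal` only; nothing modified.  Net new unproved facts: 0.
-/

noncomputable section

open scoped InnerProductSpace ComplexConjugate BigOperators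

namespace Literature.MathematicalPhysics.QuantumFieldTheory.Balaban1983to89.B9Eq3126KFloorWindowedDiagonal

open B9SectCLatticeCarrier (Bond)

section Ratio

/-- the size of the bond tent against its margin floor at print's point: `L³(L²∕4)^n = 1215·(27∕4)^n · (L^{−(n+2)}(L³∕27)^n L⁵∕1215)`, the numerals
`4, 27` as letters (private helper). [folklore] -/
private theorem size_ident (L A4 A27 : ℝ) (n : ℕ) (hL : L ≠ 0) (h4 : A4 ≠ 0) (h27 : A27 ≠ 0) :
    L ^ 3 * (L ^ 2 / A4) ^ n = (1215 * (A27 / A4) ^ n) * ((L ^ (n + 1 + 1))⁻¹ * ((L ^ 3 / A27) ^ n * (L ^ 5 / 1215))) := by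
  simp only [div_pow]
  rw [pow_right_comm L 3 n, pow_right_comm L 2 n, show L ^ (n + 1 + 1) = L ^ n * L ^ 2 by ring]
  have hLn : L ^ n ≠ 0 := pow_ne_zero _ hL
  have h27n : A27 ^ n ≠ 0 := pow_ne_zero _ h27
  have h4n : A4 ^ n ≠ 0 := pow_ne_zero _ h4
  generalize L ^ n = pL at hLn ⊢
  generalize A27 ^ n = p27 at h27n ⊢
  generalize A4 ^ n = p4 at h4n ⊢
  field_simp

/-- **THE RATIO STEP, LETTERS ONLY**: a margin floor `0 < β₀ ≤ D`, a size `N = ν·β₀` (`ν ≥ 0`), an averaging letter with `δQ·ν ≤ 1∕2`, a flat ratio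
`Mu∕D² ≤ Ξ` (`Mu ≥ 0`) and a form-perturbation coefficient `E ≥ 0` give a positive windowed margin `D − δQ·N ≥ D∕2` and the windowed ratio
`(2Mu + E·N²)∕(D − δQ·N)² ≤ 8Ξ + 4Eν²`. [folklore] [cite: Balaban1985BackgroundPropagators, Thm 3.11 p.416, (3.126) p.420] -/
theorem ratio_abstract {Mu Ξ N ν β₀ D δQ E : ℝ} (hβ₀ : 0 < β₀) (hD : β₀ ≤ D) (hN : N = ν * β₀) (hν : 0 ≤ ν) (hδ : δQ * ν ≤ 1 / 2)
    (hMu : 0 ≤ Mu) (hkey : Mu / D ^ 2 ≤ Ξ) (hE : 0 ≤ E) :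
    0 < D - δQ * N ∧ (2 * Mu + E * N ^ 2) / (D - δQ * N) ^ 2 ≤ 8 * Ξ + 4 * E * ν ^ 2 := by
  have hDpos : 0 < D := lt_of_lt_of_le hβ₀ hD
  have hN0 : 0 ≤ N := by rw [hN]; positivity
  have hδN : δQ * N ≤ D / 2 := by
    rw [hN]
    calc δQ * (ν * β₀) = δQ * ν * β₀ := by ring
      _ ≤ 1 / 2 * D := mul_le_mul hδ hD hβ₀.le (by norm_num)
      _ = D / 2 := by ring
  have hβU : D / 2 ≤ D - δQ * N := by linarith
  have hβUpos : 0 < D - δQ * N := lt_of_lt_of_le (by positivity) hβU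
  refine ⟨hβUpos, ?_⟩
  have hMuΞ : Mu ≤ Ξ * D ^ 2 := (div_le_iff₀ (by positivity)).1 hkey
  have hNle : N ≤ ν * D := by rw [hN]; exact mul_le_mul_of_nonneg_left hD hν
  have hN2 : N ^ 2 ≤ (ν * D) ^ 2 := pow_le_pow_left₀ hN0 hNle 2
  have hnum : 2 * Mu + E * N ^ 2 ≤ (2 * Ξ + E * ν ^ 2) * D ^ 2 :=
    calc 2 * Mu + E * N ^ 2 ≤ 2 * (Ξ * D ^ 2) + E * (ν * D) ^ 2 := add_le_add (by linarith) (mul_le_mul_of_nonneg_left hN2 hE)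
      _ = (2 * Ξ + E * ν ^ 2) * D ^ 2 := by ring
  have hnum0 : 0 ≤ 2 * Mu + E * N ^ 2 := by positivity
  have hden : (D / 2) ^ 2 ≤ (D - δQ * N) ^ 2 := pow_le_pow_left₀ (by positivity) hβU 2
  calc (2 * Mu + E * N ^ 2) / (D - δQ * N) ^ 2 ≤ (2 * Mu + E * N ^ 2) / (D / 2) ^ 2 :=
        div_le_div_of_nonneg_left hnum0 (by positivity) hden
    _ ≤ (2 * Ξ + E * ν ^ 2) * D ^ 2 / (D / 2) ^ 2 := div_le_div_of_nonneg_right hnum (by positivity)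
    _ = 8 * Ξ + 4 * E * ν ^ 2 := by field_simp; ring

variable {d : ℕ} (L : ℕ) {c₀ c₁ : ℝ} [Fact (0 < c₁)] (η : ℝ)

/-- **THE WINDOWED RATIO AT PRINT's POINT.**  With `ηL = 1`, `c₀L^d = c₁`, the tent's numbers `A ≥ B ≥ 0` (margin floor
`L^{−(d+1)}(L³∕27)^{d−1}L⁵∕1215 ≤ A − B`, size ceiling `A + B ≤ L^{−(d+1)}(L³∕6)^{d−1}L·L⁴∕12`), a curvature form letter `Kc ≥ 0`, a transporter letter `εR`
and an averaging letter `δQ` with `δQ·1215(27∕4)^{d−1} ≤ 1∕2`: the windowed margin `β_U = (A − B) − δQ·N` is POSITIVE and the windowed energy-over-margin²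
of `B9Eq3126KFloorWindowedTower` is `≤ Ξ_U := 8·Ξ(d,a) + 4·(34d(‖η⁻¹‖εR)² + Kc + 2aδQ²)·(1215(27∕4)^{d−1})²` — every power of the block size cancels
(`N = L³(L²∕4)^{d−1} = 1215(27∕4)^{d−1}·β₀`). [folklore] [cite: Balaban1985BackgroundPropagators, Thm 3.11 p.416, (3.126) p.420; Balaban1985Variational, (46) p.285] -/
theorem windowed_ratio_le_diagonal (hL3 : 3 ≤ L) (hd : 1 ≤ d) (hη : η * L = 1) (hw : c₀ * (L : ℝ) ^ d = c₁) {a : ℝ} (ha : 0 ≤ a) {A B : ℝ}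
    (hB : 0 ≤ B) (hAB : ((L : ℝ) ^ (d + 1))⁻¹ * (((L : ℝ) ^ 3 / 27) ^ (d - 1) * ((L : ℝ) ^ 5 / 1215)) ≤ A - B)
    (hS : A + B ≤ ((L : ℝ) ^ (d + 1))⁻¹ * (((L : ℝ) ^ 3 / 6) ^ (d - 1) * ((L : ℝ) * ((L : ℝ) ^ 4 / 12))))
    {εR Kc δQ : ℝ} (hKc : 0 ≤ Kc) (hδ : δQ * (1215 * ((27 : ℝ) / 4) ^ (d - 1)) ≤ 1 / 2) :
    0 < (A - B) - δQ * Real.sqrt (((L : ℝ) ^ 3 * ((L : ℝ) ^ 2 / 4) ^ (d - 1)) ^ 2 * (c₀ * (L : ℝ) ^ d / c₁)) ∧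
    (2 * (‖((η : ℂ))⁻¹‖ ^ 2 * (6 * (L : ℝ) ^ 2 * ((L : ℝ) ^ 2 / 4) ^ (d - 1)) ^ 2 * (5 * (d : ℝ)) * (c₀ * (L : ℝ) ^ d / c₁) + a * (2 * (A ^ 2 + B ^ 2))) +
        (2 * (4 * Real.sqrt d * (‖((η : ℂ))⁻¹‖ * εR)) ^ 2 + 2 * (‖((η : ℂ))⁻¹‖ * εR * Real.sqrt d) ^ 2 + Kc + 2 * a * δQ ^ 2) *
          (((L : ℝ) ^ 3 * ((L : ℝ) ^ 2 / 4) ^ (d - 1)) ^ 2 * (c₀ * (L : ℝ) ^ d / c₁))) /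
      ((A - B) - δQ * Real.sqrt (((L : ℝ) ^ 3 * ((L : ℝ) ^ 2 / 4) ^ (d - 1)) ^ 2 * (c₀ * (L : ℝ) ^ d / c₁))) ^ 2 ≤
    8 * (180 * (d : ℝ) * 1215 ^ 2 * ((27 : ℝ) ^ 2 / 4 ^ 2) ^ (d - 1) + 2 * a * (1215 / 12) ^ 2 * ((27 : ℝ) ^ 2 / 6 ^ 2) ^ (d - 1)) +
      4 * (34 * (d : ℝ) * (‖((η : ℂ))⁻¹‖ * εR) ^ 2 + Kc + 2 * a * δQ ^ 2) * (1215 * ((27 : ℝ) / 4) ^ (d - 1)) ^ 2 := by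
  have hc₁ : 0 < c₁ := Fact.out
  have hL0 : (0 : ℝ) < L := by exact_mod_cast (by omega : 0 < L)
  -- the flat ratio `M_u/(A−B)² ≤ Ξ`
  have key := B9Eq3126KFloorDiagonal.tent_ratio_le_diagonal (c₀ := c₀) (c₁ := c₁) L η hL3 hd hη hw ha hB hAB hS
  obtain ⟨n, rfl⟩ : ∃ n, d = n + 1 := ⟨d - 1, by omega⟩
  simp only [Nat.add_sub_cancel] at hAB hS hδ key ⊢
  have hw' : c₀ * (L : ℝ) ^ (n + 1) / c₁ = 1 := by rw [hw, div_self hc₁.ne']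
  simp only [hw', mul_one] at key ⊢
  have hN0 : 0 ≤ (L : ℝ) ^ 3 * ((L : ℝ) ^ 2 / 4) ^ n := by positivity
  rw [Real.sqrt_sq hN0]
  -- `2(4√d x)² + 2(x√d)² = 34 d x²`
  have hs : Real.sqrt ((n + 1 : ℕ) : ℝ) ^ 2 = ((n + 1 : ℕ) : ℝ) := Real.sq_sqrt (Nat.cast_nonneg _)
  have hE34 : 2 * (4 * Real.sqrt ((n + 1 : ℕ) : ℝ) * (‖((η : ℂ))⁻¹‖ * εR)) ^ 2 + 2 * (‖((η : ℂ))⁻¹‖ * εR * Real.sqrt ((n + 1 : ℕ) : ℝ)) ^ 2 + Kc +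
      2 * a * δQ ^ 2 = 34 * ((n + 1 : ℕ) : ℝ) * (‖((η : ℂ))⁻¹‖ * εR) ^ 2 + Kc + 2 * a * δQ ^ 2 := by
    linear_combination (34 * (‖((η : ℂ))⁻¹‖ * εR) ^ 2) * hs
  rw [hE34]
  have hβ₀pos : 0 < ((L : ℝ) ^ (n + 1 + 1))⁻¹ * (((L : ℝ) ^ 3 / 27) ^ n * ((L : ℝ) ^ 5 / 1215)) := by positivity
  have hABpos : 0 < A - B := lt_of_lt_of_le hβ₀pos hAB
  have hA0 : 0 ≤ A := by linarith
  exact ratio_abstract hβ₀pos hAB (size_ident (L : ℝ) 4 27 n hL0.ne' (by norm_num) (by norm_num)) (by positivity) hδ (by positivity) key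
    (by positivity)


end Ratio

section Windowed

open B4Sect5Torus (TSite)
open B9Eq319QprimeTorus (fineP)
open B9Eq315QTorus (perCfg cornerSite)
open B9Eq315QTower (towerP UlevOf)
open B7Prop1Explicit (U1 Wcx boxVec)
open B11Eq103H1Complex (BondL2K H1LatticeK KinvLatticeK)
open B9Eq310HessianOperator (adTransportW curvOp)
open B9Eq326OperatorTower (QkW laplaceAk)

variable {d : ℕ} {𝔸 : Type*} [NormedRing 𝔸] [NormedAlgebra ℂ 𝔸] [CompleteSpace 𝔸] [NormOneClass 𝔸] [StarRing 𝔸] [StarModule ℂ 𝔸]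
  (L : ℕ) [NeZero L] (m : Fin d → ℕ) [∀ i, NeZero (m i)] (n : ℕ) (hL : 1 ≤ L)
  {W : Type*} [NormedAddCommGroup W] [InnerProductSpace ℂ W] [FiniteDimensional ℂ W] (φ : W ≃ₗ[ℂ] 𝔸) {c₀ c₁ : ℝ} [Fact (0 < c₀)] [Fact (0 < c₁)]
  (η : ℝ) (τ : 𝔸 →ₗ[ℂ] ℂ) (U : Bond d (towerP L m (n + 1)) → 𝔸ˣ)
  (α : ℕ → ℝ) (hα1 : ∀ j, α j ≤ 1 / 64)
  (hU1 : ∀ (j : ℕ) (x : B7Prop1Explicit.Site d) (κ : Fin d), perCfg (towerP L m (j + 1)) (UlevOf L m (n + 1) U j) x κ ∈ U1 𝔸)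
  (hreg : ∀ (j : ℕ) (y : TSite d (towerP L m j)) (κ : Fin d) (r : Fin d → Fin L),
    ‖((Wcx L (perCfg (towerP L m (j + 1)) (UlevOf L m (n + 1) U j)) (cornerSite L y) κ (boxVec L r) : 𝔸ˣ) : 𝔸) - 1‖ ≤ α j)
  (α₁ : ℕ → ℝ) (hα1₁ : ∀ j, α₁ j ≤ 1 / 64)
  (hU1₁ : ∀ (j : ℕ) (x : B7Prop1Explicit.Site d) (κ : Fin d),
    perCfg (towerP L m (j + 1)) (UlevOf L m (n + 1) (fun _ : Bond d (towerP L m (n + 1)) => (1 : 𝔸ˣ)) j) x κ ∈ U1 𝔸)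
  (hreg₁ : ∀ (j : ℕ) (y : TSite d (towerP L m j)) (κ : Fin d) (r : Fin d → Fin L),
    ‖((Wcx L (perCfg (towerP L m (j + 1)) (UlevOf L m (n + 1) (fun _ : Bond d (towerP L m (n + 1)) => (1 : 𝔸ˣ)) j)) (cornerSite L y) κ
      (boxVec L r) : 𝔸ˣ) : 𝔸) - 1‖ ≤ α₁ j)
  (hLk : 1 ≤ L ^ (n + 1)) {α' : ℝ} (hα1' : α' ≤ 1 / 64)
  (hU1' : ∀ (x : B7Prop1Explicit.Site d) (κ : Fin d),
    perCfg (fineP (L ^ (n + 1)) m) (fun _ : Bond d (fineP (L ^ (n + 1)) m) => (1 : 𝔸ˣ)) x κ ∈ U1 𝔸)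
  (hreg' : ∀ (y : TSite d m) (κ : Fin d) (r : Fin d → Fin (L ^ (n + 1))),
    ‖((Wcx (L ^ (n + 1)) (perCfg (fineP (L ^ (n + 1)) m) (fun _ : Bond d (fineP (L ^ (n + 1)) m) => (1 : 𝔸ˣ))) (cornerSite (L ^ (n + 1)) y) κ
      (boxVec (L ^ (n + 1)) r) : 𝔸ˣ) : 𝔸) - 1‖ ≤ α')
  (h : towerP L m (n + 1) = fineP (L ^ (n + 1)) m)


include hLk hα1' hU1' hreg' h hα1₁ hU1₁ hreg₁ in
/-- **THE WINDOWED BACKGROUND AT `k` LEVELS ON PRINT's DIAGONAL — LEVEL-FREE GIVEN THE LETTERS.**  The bound of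
`B9Eq3126KFloorWindowedTower.norm_KinvLatticeK_H1LatticeK_tower_windowed_le` at print's point `ηL^{n+1} = 1`, `c₀(L^{n+1})^d = c₁`: for `3 ≤ L^{n+1}`,
`1 ≤ d`, `a > 0`, the displayed adjointness `hRS` and symmetry `hsym`, a transporter letter `εR`, a curvature form letter `Kc`, an averaging letter `δQ` SMALL
in the pure-`d` sense `δQ·1215(27∕4)^{d−1} ≤ 1∕2` (this REPLACES the positivity hypothesis `β_U > 0` of the previous file — it implies `β_U ≥ (A−B)∕2`), a
coercivity constant `γ`, ANY `hpos`, `hQ`: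
`‖(Q_k(U)G_k(U)Q_k(U)†)⁻¹y‖ ≤ Ξ_U·‖y‖`, `‖H_{1,k}(U)b‖ ≤ √(Ξ_U∕γ)·‖b‖`, `Ξ_U = 8·Ξ(d,a) + 4·(34d(‖η⁻¹‖εR)² + Kc + 2aδQ²)·(1215(27∕4)^{d−1})²`,
`Ξ(d,a) = 180d·1215²(27²∕4²)^{d−1} + 2a(1215∕12)²(27²∕6²)^{d−1}` — NO block size, NO level count, NO volume, NO operator bound of `Δ^{(k)}_a(U)`; the only
level-carrying factor left is `‖η⁻¹‖εR`, which is `2M_φM_φ′·α` for the bond window `‖U(b) − 1‖ ≤ αη` (next file). [folklore]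
[cite: Balaban1985BackgroundPropagators, (3.126) p.420, Thm 3.11 p.416, (3.79) p.406; Balaban1985Variational, (45)–(46) p.285] -/
theorem norm_KinvLatticeK_H1LatticeK_tower_windowed_le_diagonal (hL3 : 3 ≤ L ^ (n + 1)) (hd : 1 ≤ d)
    (hη : η * (((L ^ (n + 1) : ℕ) : ℝ)) = 1) (hw : c₀ * (((L ^ (n + 1) : ℕ) : ℝ)) ^ d = c₁) {a : ℝ} (ha : 0 < a)
    (hRS : ∀ (b : Bond d (towerP L m (n + 1))) (v u : W), ⟪adTransportW φ U b v, u⟫_ℂ = ⟪v, adTransportW φ (fun b => (U b)⁻¹) b u⟫_ℂ)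
    (hsym : (laplaceAk L m n φ η U hL α hα1 hU1 hreg τ (c₀ := c₀) (c₁ := c₁) a).IsSymmetric)
    {εR : ℝ} (hεR : 0 ≤ εR) (hR : ∀ (b : Bond d (towerP L m (n + 1))) (w : W), ‖adTransportW φ U b w - w‖ ≤ εR * ‖w‖)
    {Kc : ℝ} (hKc : 0 ≤ Kc) (hcurv : ∀ x : BondL2K ℂ d (towerP L m (n + 1)) c₀ W, ‖⟪x, curvOp φ τ η U x⟫_ℂ‖ ≤ Kc * ‖x‖ ^ 2)
    {δQ : ℝ} (hδQ : 0 ≤ δQ)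
    (hQd : ∀ f : BondL2K ℂ d (towerP L m (n + 1)) c₀ W,
      ‖QkW L m n φ U hL α hα1 hU1 hreg (c₀ := c₀) (c₁ := c₁) f -
        QkW L m n φ (fun _ : Bond d (towerP L m (n + 1)) => (1 : 𝔸ˣ)) hL α₁ hα1₁ hU1₁ hreg₁ (c₀ := c₀) (c₁ := c₁) f‖ ≤ δQ * ‖f‖)
    (hδ : δQ * (1215 * ((27 : ℝ) / 4) ^ (d - 1)) ≤ 1 / 2)
    {γ : ℝ} (hγ : 0 < γ)
    (hcoer : ∀ x : BondL2K ℂ d (towerP L m (n + 1)) c₀ W, γ * ‖x‖ ^ 2 ≤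
      RCLike.re ⟪x, laplaceAk L m n φ η U hL α hα1 hU1 hreg τ (c₀ := c₀) (c₁ := c₁) a x⟫_ℂ)
    (hpos : ∀ x : BondL2K ℂ d (towerP L m (n + 1)) c₀ W, x ≠ 0 →
      0 < RCLike.re ⟪x, laplaceAk L m n φ η U hL α hα1 hU1 hreg τ (c₀ := c₀) (c₁ := c₁) a x⟫_ℂ)
    (hQ : Function.Surjective (QkW L m n φ U hL α hα1 hU1 hreg (c₀ := c₀) (c₁ := c₁))) :
    (∀ y : BondL2K ℂ d m c₁ W, ‖KinvLatticeK hpos hQ y‖ ≤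
        (8 * (180 * (d : ℝ) * 1215 ^ 2 * ((27 : ℝ) ^ 2 / 4 ^ 2) ^ (d - 1) + 2 * a * (1215 / 12) ^ 2 * ((27 : ℝ) ^ 2 / 6 ^ 2) ^ (d - 1)) +
          4 * (34 * (d : ℝ) * (‖((η : ℂ))⁻¹‖ * εR) ^ 2 + Kc + 2 * a * δQ ^ 2) * (1215 * ((27 : ℝ) / 4) ^ (d - 1)) ^ 2) * ‖y‖) ∧
      ∀ b : BondL2K ℂ d m c₁ W, ‖H1LatticeK hpos hQ b‖ ≤
        Real.sqrt ((8 * (180 * (d : ℝ) * 1215 ^ 2 * ((27 : ℝ) ^ 2 / 4 ^ 2) ^ (d - 1) + 2 * a * (1215 / 12) ^ 2 * ((27 : ℝ) ^ 2 / 6 ^ 2) ^ (d - 1)) +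
          4 * (34 * (d : ℝ) * (‖((η : ℂ))⁻¹‖ * εR) ^ 2 + Kc + 2 * a * δQ ^ 2) * (1215 * ((27 : ℝ) / 4) ^ (d - 1)) ^ 2) / γ) * ‖b‖ := by
  -- the three numbers of the tent at block `L^{n+1}` and the ratio step at print's point
  obtain ⟨hB, hAB, hS⟩ := B9Eq3126KFloorDiagonal.tent_numbers_bounds (d := d) (L ^ (n + 1)) hL3
  obtain ⟨hβU, hratio⟩ := windowed_ratio_le_diagonal (c₀ := c₀) (c₁ := c₁) (L ^ (n + 1)) η hL3 hd hη hw ha.le hB hAB hS (εR := εR) hKc hδ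
  obtain ⟨hK, hH⟩ := B9Eq3126KFloorWindowedTower.norm_KinvLatticeK_H1LatticeK_tower_windowed_le L m n hL φ η τ U α hα1 hU1 hreg α₁ hα1₁ hU1₁ hreg₁
    hLk hα1' hU1' hreg' h hL3 ha hRS hsym hεR hR hKc hcurv hδQ hQd hβU hγ hcoer hpos hQ
  refine ⟨fun y => (hK y).trans (mul_le_mul_of_nonneg_right hratio (norm_nonneg _)), fun b =>
    (hH b).trans (mul_le_mul_of_nonneg_right (Real.sqrt_le_sqrt ?_) (norm_nonneg _))⟩
  rw [mul_comm γ, ← div_div]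
  exact div_le_div_of_nonneg_right hratio hγ.le

end Windowed

end Literature.MathematicalPhysics.QuantumFieldTheory.Balaban1983to89.B9Eq3126KFloorWindowedDiagonal

end
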